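import Summits.QuantumFields.BalabanUV.Beta.FP.PeriodisedBorderTables

/-!
# `BalabanUV.Beta.FP.PeriodisedBorderTablesSorted` — road «FP» for binder row D1, ROUTE T row **(T-ID)**, border-table half: **THE DEAD MULTIPLIER SLOTS OF THE
# TORUS BORDER MATRICES COMPRESS AWAY** — sorting the torus index `Idx M (Fib d)` live ⊕ dead along `Equiv.sumCompl P` for ANY decidable `P` whose complement
# lies in the off-sublattice multiplier slots, the periodised packer-shaped insertion `perF M (dper M (packK N T κ u))` IS its live block padded by zeros
# (the jets' analogue of leaf-05's `RelInvPeriodised.compress_of_rules`, third conjunct — suggested in W-d1leaf05g23-3 (3), journal l.36821)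

HONEST DEPENDENCY (page 1, mandatory): continuum YM on T⁴ ⇐ BetaPertH ∧ nine spine estimates (0/9 proved); BetaPertH ⇐ (D1) ∧ (D4) ∧ CAP+tail;
G-an2-4 gates asym, D1 and NE2/3/4.  HONEST FRAMING (cell contract, verbatim): «discharging `BetaPertH` makes Bałaban's UV stability UNCONDITIONAL —
a real constructive-QFT result; it is NOT the continuum limit and NOT the Clay problem.»  ABSOLUTE RULE (cell charter, verbatim): «No internally-minted
statement may enter as a cited fact. Every hypothesis is either kernel-proved in this package or a verbatim quotation of a PUBLISHED theorem with page
reference. The manuscript(s) under audit are NOT citable for their own disputed steps — they are the thing under adjudication; programme-internal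
(2001/route/tribunal) claims are never citable.»  THIS MODULE is [folklore] finite-matrix bookkeeping (`Matrix.submatrix` ∕ `fromBlocks` ∕ `toBlocks₁₁`) over
leaf-02's `PeriodisedBorderTables` §3; no `def`, no `def … : Prop`, nothing cited, 0 sorry; 0 estimates; 0∕4 row-D1 binders; NOT (T-ID) itself, NOT (T-INV),
NOT SDF, NOT D1, NOT BetaPertH, NOT continuum, NOT Clay.  «not in print; our bookkeeping».

CONTENT.
* §1 generic (any index `ι`, any `Zero R`): **`submatrix_sumCompl_eq_fromBlocks_of_dead`** — a matrix whose `¬P`-rows and `¬P`-columns vanish, sorted along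
  `Equiv.sumCompl P`, is `fromBlocks X_live 0 0 0`; the vanishing is inherited by finite linear combinations (`dead_rows_sum_smul` ∕ `dead_cols_sum_smul`).
* §2 the torus border matrices: for `N ∣ M` (shape `M = N·M′`) and ANY decidable live reading `P` on `Idx M (Fib d)` with
  **`hP : ∀ p, ¬P p → ∃ ρ, p.2 = inr ρ ∧ off N p̃ ≠ 0`** (the dead slots are off-sublattice multiplier slots — field slots and on-lattice multipliers are live,
  whatever finer sorting the consumer applies inside them): `perF_dper_packK_dead_row ∕ _dead_col` and
  `perF_dper_packK_eq_zero_of_not_live` (`¬(P p ∧ P q) → X p q = 0` — the EMBEDDING-presentation shape of leaf-05's `compress_of_rules_embedding` (3)),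
  **`perF_dper_packK_sorted : X.submatrix (sumCompl P) (sumCompl P) = fromBlocks (X.submatrix …).toBlocks₁₁ 0 0 0`** for `X = perF M (dper M (packK N T κ u))`, and the same for a
  finite bond-weighted sum `Σ_{b∈s} h b • perF M (dper M (packK N (T b) (κ b) (u b)))` (`perF_dper_packK_sum_sorted`) — the background jets of the border slot.
NOT HERE: which `P` the instance uses (leaf-05's `axEc`-support reading is NOT admissible for the jets — comb FIELD bonds are live data of the jets; the jets'
dead set is the off-sublattice multipliers only); the `kkt` dress; the H-∕K-slots.  Provenance: D1 formalisation swarm LEAF PROVER 02, unit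
b2b-balaban-beta-d1-formalise-leaf-02 gen 16, 2026-08-21.  No existing file touched. -/

noncomputable section

open scoped BigOperators

namespace Summit.QuantumFields.BalabanUV.Beta.FP.PeriodisedBorderTablesSorted

open Literature.MathematicalPhysics.QuantumFieldTheory.Balaban1983to89
open Literature.MathematicalPhysics.QuantumFieldTheory.Balaban1983to89.Beta
open B6Lemma24Torus (pbox)
open ExpKernelCalculus (MKer)
open AffineAveraging (Site)
open AveragingContours (off)
open OneStepResolventKernel (Fib)
open Summit.QuantumFields.BalabanUV.Beta.FP.KernelPeriodisationFib (perF perF_apply Idx)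
open Summit.QuantumFields.BalabanUV.Beta.FP.KernelPeriodisationFibLoc (dper)
open Summit.QuantumFields.BalabanUV.Beta.FP.CompositeBorderTables (packK)
open Summit.QuantumFields.BalabanUV.Beta.FP.PeriodisedBorderTables (perZ_dper_packK_inr_inr perZ_dper_packK_inl_inr_of_off_ne_zero
  perZ_dper_packK_inr_inl_of_off_ne_zero)

variable {d : ℕ}

/-! ## §1 Generic: sorting a matrix with dead rows and columns -/

section Generic

variable {ι R : Type*} [Zero R] (P : ι → Prop) [DecidablePred P]

/-- [folklore] **A MATRIX WITH VANISHING `¬P`-ROWS AND `¬P`-COLUMNS, SORTED live ⊕ dead ALONG `Equiv.sumCompl P`, IS ITS LIVE BLOCK PADDED BY ZEROS.** -/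
theorem submatrix_sumCompl_eq_fromBlocks_of_dead (X : Matrix ι ι R)
    (hrow : ∀ p q, ¬P p → X p q = 0) (hcol : ∀ p q, ¬P q → X p q = 0) :
    X.submatrix (Equiv.sumCompl P) (Equiv.sumCompl P) =
      Matrix.fromBlocks ((X.submatrix (Equiv.sumCompl P) (Equiv.sumCompl P)).toBlocks₁₁) 0 0 0 := by
  ext (i | i) (j | j)
  · rfl
  · rw [Matrix.submatrix_apply, Matrix.fromBlocks_apply₁₂, Matrix.zero_apply, Equiv.sumCompl_apply_inr]
    exact hcol _ _ j.2
  · rw [Matrix.submatrix_apply, Matrix.fromBlocks_apply₂₁, Matrix.zero_apply, Equiv.sumCompl_apply_inr]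
    exact hrow _ _ i.2
  · rw [Matrix.submatrix_apply, Matrix.fromBlocks_apply₂₂, Matrix.zero_apply, Equiv.sumCompl_apply_inr]
    exact hrow _ _ i.2

variable {R : Type*} [Semiring R] {κ : Type*}

omit [DecidablePred P] in
/-- [folklore] dead rows are inherited by finite linear combinations. -/
theorem dead_rows_sum_smul (s : Finset κ) (h : κ → R) (X : κ → Matrix ι ι R) (hrow : ∀ b ∈ s, ∀ p q, ¬P p → X b p q = 0)
    (p q : ι) (hp : ¬P p) : (∑ b ∈ s, h b • X b) p q = 0 := by
  rw [Matrix.sum_apply]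
  exact Finset.sum_eq_zero fun b hb => by rw [Matrix.smul_apply, hrow b hb p q hp, smul_zero]

omit [DecidablePred P] in
/-- [folklore] … and so are dead columns. -/
theorem dead_cols_sum_smul (s : Finset κ) (h : κ → R) (X : κ → Matrix ι ι R) (hcol : ∀ b ∈ s, ∀ p q, ¬P q → X b p q = 0)
    (p q : ι) (hq : ¬P q) : (∑ b ∈ s, h b • X b) p q = 0 := by
  rw [Matrix.sum_apply]
  exact Finset.sum_eq_zero fun b hb => by rw [Matrix.smul_apply, hcol b hb p q hq, smul_zero]

end Generic

/-! ## §2 The torus border matrices: off-sublattice multiplier slots are dead -/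

section Border

variable {N : ℕ} {M M' : Fin (d + 1) → ℕ} (P : Idx M (Fib d) → Prop) [DecidablePred P]

omit [DecidablePred P] in
/-- [folklore] **dead ROWS**: if every `¬P` slot is an off-sublattice multiplier slot, the `¬P`-rows of `perF M (dper M (packK N T κ u))` vanish
(mf off-lattice row by `PeriodisedBorderTables` §3, mm block identically). -/
theorem perF_dper_packK_dead_row (hM : ∀ i, M i = N * M' i)
    (hP : ∀ p : Idx M (Fib d), ¬P p → ∃ ρ : Fin (d + 1), p.2 = Sum.inr ρ ∧ off N (p.1 : Site (d + 1)) ≠ 0)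
    (T : Fin (d + 1) → Site (d + 1) → MKer (d + 1) (Fib d)) (κ : Fin (d + 1)) (u : Site (d + 1))
    (p q : Idx M (Fib d)) (hp : ¬P p) : perF M (dper M (packK N T κ u)) p q = 0 := by
  obtain ⟨ρ, hρ, hoff⟩ := hP p hp
  obtain ⟨r, a⟩ := p
  obtain ⟨s, b⟩ := q
  simp only at hρ hoff
  subst hρ
  rw [perF_apply]
  rcases b with α | ρ'
  · exact perZ_dper_packK_inr_inl_of_off_ne_zero T κ u hM hoff _ ρ α
  · exact perZ_dper_packK_inr_inr T κ u _ _ ρ ρ'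

omit [DecidablePred P] in
/-- [folklore] **dead COLUMNS** likewise (fm off-lattice column, mm block). -/
theorem perF_dper_packK_dead_col (hM : ∀ i, M i = N * M' i)
    (hP : ∀ p : Idx M (Fib d), ¬P p → ∃ ρ : Fin (d + 1), p.2 = Sum.inr ρ ∧ off N (p.1 : Site (d + 1)) ≠ 0)
    (T : Fin (d + 1) → Site (d + 1) → MKer (d + 1) (Fib d)) (κ : Fin (d + 1)) (u : Site (d + 1))
    (p q : Idx M (Fib d)) (hq : ¬P q) : perF M (dper M (packK N T κ u)) p q = 0 := by
  obtain ⟨ρ, hρ, hoff⟩ := hP q hq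
  obtain ⟨r, a⟩ := p
  obtain ⟨s, b⟩ := q
  simp only at hρ hoff
  subst hρ
  rw [perF_apply]
  rcases a with α | ρ'
  · exact perZ_dper_packK_inl_inr_of_off_ne_zero T κ u hM hoff _ α ρ
  · exact perZ_dper_packK_inr_inr T κ u _ _ ρ' ρ

omit [DecidablePred P] in
/-- [folklore] the EMBEDDING-presentation form (leaf-05 g24's `compress_of_rules_embedding` (3) shape): an entry with a dead row OR column index vanishes. -/
theorem perF_dper_packK_eq_zero_of_not_live (hM : ∀ i, M i = N * M' i)
    (hP : ∀ p : Idx M (Fib d), ¬P p → ∃ ρ : Fin (d + 1), p.2 = Sum.inr ρ ∧ off N (p.1 : Site (d + 1)) ≠ 0)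
    (T : Fin (d + 1) → Site (d + 1) → MKer (d + 1) (Fib d)) (κ : Fin (d + 1)) (u : Site (d + 1))
    (p q : Idx M (Fib d)) (hpq : ¬(P p ∧ P q)) : perF M (dper M (packK N T κ u)) p q = 0 := by
  by_cases hp : P p
  · exact perF_dper_packK_dead_col P hM hP T κ u p q fun hq => hpq ⟨hp, hq⟩
  · exact perF_dper_packK_dead_row P hM hP T κ u p q hp

/-- [folklore] **`perF_dper_packK_sorted` — THE TORUS BORDER MATRIX IS ITS LIVE BLOCK PADDED BY ZEROS** under any live reading whose dead slots are
off-sublattice multiplier slots. -/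
theorem perF_dper_packK_sorted (hM : ∀ i, M i = N * M' i)
    (hP : ∀ p : Idx M (Fib d), ¬P p → ∃ ρ : Fin (d + 1), p.2 = Sum.inr ρ ∧ off N (p.1 : Site (d + 1)) ≠ 0)
    (T : Fin (d + 1) → Site (d + 1) → MKer (d + 1) (Fib d)) (κ : Fin (d + 1)) (u : Site (d + 1)) :
    (perF M (dper M (packK N T κ u))).submatrix (Equiv.sumCompl P) (Equiv.sumCompl P) =
      Matrix.fromBlocks (((perF M (dper M (packK N T κ u))).submatrix (Equiv.sumCompl P) (Equiv.sumCompl P)).toBlocks₁₁) 0 0 0 :=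
  submatrix_sumCompl_eq_fromBlocks_of_dead P _ (fun p q hp => perF_dper_packK_dead_row P hM hP T κ u p q hp)
    fun p q hq => perF_dper_packK_dead_col P hM hP T κ u p q hq

variable {β : Type*}

/-- [folklore] **THE BACKGROUND JET OF THE BORDER SLOT, SORTED**: a finite bond-weighted sum of torus border matrices is its live block padded by zeros. -/
theorem perF_dper_packK_sum_sorted (hM : ∀ i, M i = N * M' i)
    (hP : ∀ p : Idx M (Fib d), ¬P p → ∃ ρ : Fin (d + 1), p.2 = Sum.inr ρ ∧ off N (p.1 : Site (d + 1)) ≠ 0)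
    (s : Finset β) (h : β → ℝ) (T : β → Fin (d + 1) → Site (d + 1) → MKer (d + 1) (Fib d)) (κ : β → Fin (d + 1)) (u : β → Site (d + 1)) :
    (∑ b ∈ s, h b • perF M (dper M (packK N (T b) (κ b) (u b)))).submatrix (Equiv.sumCompl P) (Equiv.sumCompl P) =
      Matrix.fromBlocks
        (((∑ b ∈ s, h b • perF M (dper M (packK N (T b) (κ b) (u b)))).submatrix (Equiv.sumCompl P) (Equiv.sumCompl P)).toBlocks₁₁) 0 0 0 :=
  submatrix_sumCompl_eq_fromBlocks_of_dead P _
    (dead_rows_sum_smul P s h _ fun b _ p q hp => perF_dper_packK_dead_row P hM hP (T b) (κ b) (u b) p q hp)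
    (dead_cols_sum_smul P s h _ fun b _ p q hq => perF_dper_packK_dead_col P hM hP (T b) (κ b) (u b) p q hq)

end Border

end Summit.QuantumFields.BalabanUV.Beta.FP.PeriodisedBorderTablesSorted

end
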